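import Mathlib
import Summits.MatrixMultiplication.Statement
import Summits.MatrixMultiplication.MatrixMultiplication.Theorems.GraphEquationsTowerSpecialisation

/-!
# Graph equations — the identity tower at a `ℂ`-point and its 2-jet section (M25b)

From the cleared identities (`towerCleared_of_stages`: numerators `N`, one denominator `d`,
duality numerators `Cn`, a point `p` with `d(p) ≠ 0`) we extract the `ℂ`-DATA the S1 binder needs
(NODE-g36 §3, file E3):

* the SHIFT `shiftHom p : f(a,b) ↦ f(p + (a,b))` (constant term = value at `p`);
* an inverse 2-jet `ι` of `d(p + ·)` and the SECTION JETS `J x = N x (p + ·) · ι`, with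
  `g (p + (a,b), (p+(a,b))-graph, J) ∈ jetIdeal 2` for every output `g` (`hsec` up to plumbing);
* the `ℂ`-point `Λ x = N x (p) / d(p)` of the fibre (`= constantCoeff (J x)`) and a `ℂ`-matrix `PC`
  with `∑_o PC y o · (∂_{y'} g_o)(p̂) = [y = y']` (the read-out coefficients `P`).
-/

set_option linter.dupNamespace false

noncomputable section

open scoped BigOperators

namespace Summit.MatrixMultiplication.MatrixMultiplication.Theorems.GraphEquations

open MvPolynomial
open Literature.Computability.AlgebraicComplexity

variable {n : ℕ}

section Shift

variable {σ : Type*}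

/-- The shift `f ↦ f (p + x)`. -/
def shiftHom (p : σ → ℂ) : MvPolynomial σ ℂ →ₐ[ℂ] MvPolynomial σ ℂ :=
  aeval fun u => C (p u) + X u

/-- `shiftHom` on variables. -/
@[simp] theorem shiftHom_X (p : σ → ℂ) (u : σ) : shiftHom p (X u) = C (p u) + X u := by
  rw [shiftHom, aeval_X]

/-- The constant term of the shifted polynomial is the value at the point. -/
theorem constantCoeff_shiftHom (p : σ → ℂ) (f : MvPolynomial σ ℂ) :
    constantCoeff (shiftHom p f) = aeval p f := by
  induction f using MvPolynomial.induction_on with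
  | C a =>
    rw [shiftHom, aeval_C, aeval_C, algebraMap_eq, constantCoeff_C]
    simp
  | add f g hf hg => rw [map_add, map_add, map_add, hf, hg]
  | mul_X f u hf => rw [map_mul, map_mul, map_mul, hf, shiftHom_X, aeval_X, map_add, constantCoeff_C,
      constantCoeff_X, add_zero]

end Shift

section Point

variable {κ : Type} [DecidableEq κ]

set_option maxHeartbeats 800000 in
/-- **The tower at a `ℂ`-point.**  See the module docstring.  Inputs are exactly the outputs of
`towerCleared_of_stages`. -/
theorem towerPoint_of_cleared {T : ℕ} (t : Fin T → MvPolynomial (GraphVars n) ℂ)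
    (W : List (List (Derivation ℂ (MvPolynomial (GraphVars n ⊕ κ) ℂ)
      (MvPolynomial (GraphVars n ⊕ κ) ℂ))))
    (ex : List (MvPolynomial (GraphVars n ⊕ κ) ℂ))
    (N : κ → MvPolynomial (MatMulVars n) ℂ) (d : MvPolynomial (MatMulVars n) ℂ) (M : ℕ)
    (Cn : (Fin n × Fin n) ⊕ κ → (Fin T × Fin W.length) ⊕ Fin ex.length →
      MvPolynomial (MatMulVars n) ℂ)
    (p : MatMulVars n → ℂ) (hp : eval p d ≠ 0)
    (hout : ∀ o, (∀ mono ∈ (secPoly (towerOut t W ex o)).support, mono.degree ≤ M) ∧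
      clearEval (secPoly (towerOut t W ex o)) N d M = 0)
    (hM2 : ∀ o y, ∀ mono ∈ (secPoly (pderiv (fibreVar n κ y) (towerOut t W ex o))).support,
      mono.degree ≤ M)
    (hdual : ∀ y y', ∑ o, Cn y o *
      clearEval (secPoly (pderiv (fibreVar n κ y') (towerOut t W ex o))) N d M =
        if y = y' then d ^ (M + 1) else 0) :
    ∃ (ι : MvPolynomial (MatMulVars n) ℂ)
      (PC : (Fin n × Fin n) ⊕ κ → (Fin T × Fin W.length) ⊕ Fin ex.length → ℂ),
      (∀ x, constantCoeff (shiftHom p (N x) * ι) = aeval p (N x) * (aeval p d)⁻¹) ∧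
      (∀ o, aeval (Sum.elim (fun v => shiftHom p (graphRestrict n (X v)))
          (fun x => shiftHom p (N x) * ι)) (towerOut t W ex o) ∈ jetIdeal (MatMulVars n) ℂ 2) ∧
      (∀ y y', ∑ o, PC y o * aeval (Sum.elim (fun v => aeval p (graphRestrict n (X v)))
          (fun x => aeval p (N x) * (aeval p d)⁻¹)) (pderiv (fibreVar n κ y') (towerOut t W ex o)) =
        if y = y' then 1 else 0) := by
  classical
  set out := towerOut t W ex with hout'
  have hpd : aeval p d ≠ 0 := by rwa [aeval_eq_eval]
  -- the inverse jet of the shifted denominator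
  have hsd : constantCoeff (shiftHom p d) ≠ 0 := by rwa [constantCoeff_shiftHom]
  obtain ⟨ι, hι⟩ := exists_mul_sub_one_mem_jetIdeal hsd
  have hιc : constantCoeff ι = (aeval p d)⁻¹ := by
    have h0 : constantCoeff (shiftHom p d * ι - 1) = 0 := (mem_jetIdeal.mp hι) 0 (by simp)
    rw [map_sub, map_mul, map_one, constantCoeff_shiftHom, sub_eq_zero] at h0
    exact eq_inv_of_mul_eq_one_right h0
  set φ : MvPolynomial (MatMulVars n) ℂ →ₐ[ℂ] ℂ := aeval p with hφ
  have hφd : (φ : MvPolynomial (MatMulVars n) ℂ →+* ℂ) d * (φ d)⁻¹ = 1 := by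
    rw [AlgHom.coe_toRingHom]
    exact mul_inv_cancel₀ hpd
  -- the rows at the point, from the cleared gradients
  have hrow : ∀ o y', φ (clearEval (secPoly (pderiv (fibreVar n κ y') (out o))) N d M) =
      φ d ^ M * aeval (Sum.elim (fun v => φ (graphRestrict n (X v))) (fun x => φ (N x) * (φ d)⁻¹))
        (pderiv (fibreVar n κ y') (out o)) := by
    intro o y'
    have h := map_clearEval (φ : MvPolynomial (MatMulVars n) ℂ →+* ℂ) _ N d (hM2 o y') _ hφd
    rw [AlgHom.coe_toRingHom] at h
    rw [h, eval₂_secPoly]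
  refine ⟨ι, fun y o => φ (Cn y o) * (φ d)⁻¹, fun x => ?_, fun o => ?_, fun y y' => ?_⟩
  · -- constant terms of the section jets
    rw [map_mul, constantCoeff_shiftHom, hιc]
  · -- the 2-jet identities
    have h := eval₂_mem_jetIdeal_of_clearEval_eq_zero
      (shiftHom p : MvPolynomial (MatMulVars n) ℂ →+* MvPolynomial (MatMulVars n) ℂ)
      (hout o).1 (hout o).2 (ι := ι) (by rw [AlgHom.coe_toRingHom]; exact hι)
    rw [eval₂_secPoly] at h
    exact h
  · -- duality at the point
    have key := congrArg φ (hdual y y')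
    rw [map_sum] at key
    have hterm : ∀ o, φ (Cn y o * clearEval (secPoly (pderiv (fibreVar n κ y') (out o))) N d M) =
        φ d ^ (M + 1) * (φ (Cn y o) * (φ d)⁻¹ *
          aeval (Sum.elim (fun v => φ (graphRestrict n (X v))) (fun x => φ (N x) * (φ d)⁻¹))
            (pderiv (fibreVar n κ y') (out o))) := by
      intro o
      rw [map_mul, hrow, pow_succ]
      rw [show φ d ^ M * φ d * (φ (Cn y o) * (φ d)⁻¹ * aeval (Sum.elim (fun v => φ (graphRestrict n (X v)))
          (fun x => φ (N x) * (φ d)⁻¹)) (pderiv (fibreVar n κ y') (out o))) =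
          φ d ^ M * (φ d * (φ d)⁻¹) * (φ (Cn y o) * aeval (Sum.elim (fun v => φ (graphRestrict n (X v)))
          (fun x => φ (N x) * (φ d)⁻¹)) (pderiv (fibreVar n κ y') (out o))) by ring, mul_inv_cancel₀ hpd]
      ring
    rw [Finset.sum_congr rfl fun o _ => hterm o, ← Finset.mul_sum] at key
    have hpow : φ d ^ (M + 1) ≠ 0 := pow_ne_zero _ hpd
    split_ifs with h
    · subst h
      rw [if_pos rfl, map_pow] at key
      exact mul_left_cancel₀ hpow (by rw [key, mul_one])
    · rw [if_neg h, map_zero, mul_eq_zero] at key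
      exact key.resolve_left hpow

end Point

end Summit.MatrixMultiplication.MatrixMultiplication.Theorems.GraphEquations

end
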